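import Summits.QuantumFields.YangMills.Theorems.ColdStartUniversalityLatticeLangevinLipschitzExtension
import Summits.QuantumFields.YangMills.Theorems.ColdStartUniversalityShenZhuZhuRiemannDistSU2
import HarnessLib

/-!
# Extending a function on `SU(2)^E` to the real link coordinates via the quaternionic retraction, II: continuity, modulus near the group,
# and the local `ρ_L`-dilatation `1/(1 − 2r)` of the retraction under a common shift

Seat `ym-line-csu-p1` (g41), route `ColdStartUniversality` of `Summits/QuantumFields/YangMills`, helper file G53 (`--supports stmt-QuantumFields-24809`).
Continuation of part I (`…LatticeLangevinLipschitzExtension`): `F̃(x) = χ(x)·F(π(x))` with `π` the quaternionic retraction and `χ` the smooth cut-off.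

* ★ `continuous_riemannDist_two_right`, `continuous_torusRiemannDistSq_two_right`, `continuous_of_riemannLipschitz` — a `ρ_L`-Lipschitz function on
  `SU(2)^E` is continuous;
* ★★ `continuous_ext` — `F̃` is continuous whenever `F` is (where some `𝖯M_e(x)` degenerates the cut-off vanishes identically nearby);
* ★★ `ext_modulus` — `|F̃(x) − F(Q)| ≤ L_F·12·√#E·r` for `‖x − coords Q‖_∞ ≤ r ≤ 1/4` (`χ = 1`, chord distortion of the radial projection (G50),
  `ρ_L² ≤ (π²/4)·Σ chord²` (G41));
* ★★ `hsForm_retr_shift_sub_le` — under a common shift `t`, `‖t‖_∞ ≤ r ≤ 1/4`, the retraction dilates link chords by at most `1/(1 − 2r)`: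
  `‖π(coords Q' − t)_e − π(coords Q − t)_e‖_F² ≤ (1/(1−2r))²·‖Q'_e − Q_e‖_F²` (the perturbation `𝖯M_e(t)` is THE SAME for `Q` and `Q'`);
* ★★★ `torusRiemannDistSq_retr_shift_le` — hence `ρ_L(π(coords Q − t), π(coords Q' − t))² ≤ ((1/(1−2r))²/(1 − u))·ρ_L(Q,Q')²` as long as
  `(1/(1−2r))²·ρ_L(Q,Q')² ≤ 8u`, `u < 1` (arc `≤ chord/√(1 − chord²/8)` on `SU(2)`, G50).

THEOREMS ONLY, no definition (all objects are `let`-bound in the statements), no sorry.  HONEST FRAMING: finite-dimensional analysis on `SU(2)^E`;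
nothing about the route's scaling; `UniformColdStartMixing` (24809, ASIDE) not restated; no crux, rung or summit statement is proved; the Yang–Mills
mass gap is NOT proved.
-/

set_option autoImplicit false

noncomputable section

namespace Summit.QuantumFields.YangMills.Theorems.ColdStartUniversality

open MeasureTheory Matrix Complex Finset Filter Topology Set
open scoped ComplexConjugate BigOperators Real NNReal
open Literature.MathematicalPhysics.QuantumFieldTheory
open Literature.MathematicalPhysics.QuantumLattice (fundamentalRep fundamentalLatticeRep continuous_fundamentalRep fundamentalRep_apply fundamentalLatticeRep_N)

variable {L : ℕ} [NeZero L]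

/-! ## §1. `ρ_L`-Lipschitz functions are continuous -/

omit [NeZero L] in
/-- `h ↦ ρ(g, h)` is continuous on `SU(2)` (closed form `√2·arccos(Re tr(h g*)/2)`, G40). [cite: GallotHulinLafontaine2004, 2.91] -/
theorem continuous_riemannDist_two_right (g : Matrix.specialUnitaryGroup (Fin 2) ℂ) :
    Continuous fun h : Matrix.specialUnitaryGroup (Fin 2) ℂ => (fundamentalLatticeRep 2).riemannDist g h := by
  have hfun : (fun h : Matrix.specialUnitaryGroup (Fin 2) ℂ => (fundamentalLatticeRep 2).riemannDist g h) =
      fun h : Matrix.specialUnitaryGroup (Fin 2) ℂ =>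
        Real.sqrt 2 * Real.arccos ((((h : Matrix (Fin 2) (Fin 2) ℂ)) * star (g : Matrix (Fin 2) (Fin 2) ℂ)).trace.re / 2) :=
    funext fun h => riemannDist_two_eq g h
  rw [hfun]
  refine continuous_const.mul (Real.continuous_arccos.comp ?_)
  exact (Complex.continuous_re.comp ((continuous_subtype_val.matrix_mul continuous_const).matrix_trace)).div_const _

/-- `Q' ↦ ρ_L(Q, Q')²` is continuous on `SU(2)^E`. [cite: ShenZhuZhu2022, §4.1] -/
theorem continuous_torusRiemannDistSq_two_right (Q : GaugeConfig 3 L (Matrix.specialUnitaryGroup (Fin 2) ℂ)) :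
    Continuous fun Q' : GaugeConfig 3 L (Matrix.specialUnitaryGroup (Fin 2) ℂ) => torusRiemannDistSq (fundamentalLatticeRep 2) Q Q' := by
  unfold torusRiemannDistSq
  exact continuous_finsetSum _ fun e _ => ((continuous_riemannDist_two_right (Q e)).comp (continuous_apply e)).pow 2

/-- ★ **A `ρ_L`-Lipschitz function on `SU(2)^E` is continuous** (for the product topology). [cite: ShenZhuZhu2022, §4.1] -/
theorem continuous_of_riemannLipschitz {F : GaugeConfig 3 L (Matrix.specialUnitaryGroup (Fin 2) ℂ) → ℝ} {Lf : ℝ}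
    (hlip : ∀ Q Q', |F Q' - F Q| ≤ Lf * Real.sqrt (torusRiemannDistSq (fundamentalLatticeRep 2) Q Q')) : Continuous F := by
  refine continuous_iff_continuousAt.2 fun Q => ?_
  rw [ContinuousAt, tendsto_iff_norm_sub_tendsto_zero]
  have h0 : Tendsto (fun Q' => Lf * Real.sqrt (torusRiemannDistSq (fundamentalLatticeRep 2) Q Q')) (𝓝 Q) (𝓝 0) := by
    have hc : Continuous fun Q' => Lf * Real.sqrt (torusRiemannDistSq (fundamentalLatticeRep 2) Q Q') :=
      continuous_const.mul (Real.continuous_sqrt.comp (continuous_torusRiemannDistSq_two_right Q))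
    have h := hc.tendsto Q
    rwa [(torusRiemannDistSq_two_eq_zero_iff Q Q).2 rfl, Real.sqrt_zero, mul_zero] at h
  exact squeeze_zero (fun _ => norm_nonneg _) (fun Q' => by rw [Real.norm_eq_abs]; exact hlip Q Q') h0

/-! ## §2. Continuity of the extension `F̃ = χ·(F∘π)` -/

omit [NeZero L] in
/-- The quaternionic projection of the rebuilt link matrix, `x ↦ 𝖯M_e(x)`, is continuous (its entries are affine in the coordinates). [folklore] -/
theorem continuous_quatProj_rebuild (e : Edge 3 L) :
    let rebuild : (Edge 3 L × Fin 2 × Fin 2 × Bool → ℝ) → Edge 3 L → Matrix (Fin 2) (Fin 2) ℂ :=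
      fun x e => Matrix.of fun i j : Fin 2 => ((x (e, i, j, false) : ℝ) : ℂ) + ((x (e, i, j, true) : ℝ) : ℂ) * Complex.I
    let qP : Matrix (Fin 2) (Fin 2) ℂ → Matrix (Fin 2) (Fin 2) ℂ := fun M =>
      !![(M 0 0 + conj (M 1 1)) / 2, (M 0 1 - conj (M 1 0)) / 2; -conj ((M 0 1 - conj (M 1 0)) / 2), conj ((M 0 0 + conj (M 1 1)) / 2)]
    Continuous fun x : Edge 3 L × Fin 2 × Fin 2 × Bool → ℝ => qP (rebuild x e) := by
  intro rebuild qP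
  have hc : ∀ q : Edge 3 L × Fin 2 × Fin 2 × Bool, Continuous fun x : Edge 3 L × Fin 2 × Fin 2 × Bool → ℝ => ((x q : ℝ) : ℂ) :=
    fun q => Complex.continuous_ofReal.comp (continuous_apply q)
  have hent : ∀ i j : Fin 2, Continuous fun x : Edge 3 L × Fin 2 × Fin 2 × Bool → ℝ => rebuild x e i j := fun i j =>
    (hc (e, i, j, false)).add ((hc (e, i, j, true)).mul continuous_const)
  have hconj : ∀ i j : Fin 2, Continuous fun x : Edge 3 L × Fin 2 × Fin 2 × Bool → ℝ => conj (rebuild x e i j) := fun i j =>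
    Complex.continuous_conj.comp (hent i j)
  refine continuous_pi fun i => continuous_pi fun j => ?_
  fin_cases i <;> fin_cases j
  · exact ((hent 0 0).add (hconj 1 1)).div_const _
  · exact ((hent 0 1).sub (hconj 1 0)).div_const _
  · exact (Complex.continuous_conj.comp (((hent 0 1).sub (hconj 1 0)).div_const _)).neg
  · exact Complex.continuous_conj.comp (((hent 0 0).add (hconj 1 1)).div_const _)

omit [NeZero L] in
/-- `x ↦ |𝖯M_e(x)|²` is continuous. [folklore] -/
theorem continuous_hsForm_quatProj_rebuild (e : Edge 3 L) :
    let rebuild : (Edge 3 L × Fin 2 × Fin 2 × Bool → ℝ) → Edge 3 L → Matrix (Fin 2) (Fin 2) ℂ :=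
      fun x e => Matrix.of fun i j : Fin 2 => ((x (e, i, j, false) : ℝ) : ℂ) + ((x (e, i, j, true) : ℝ) : ℂ) * Complex.I
    let qP : Matrix (Fin 2) (Fin 2) ℂ → Matrix (Fin 2) (Fin 2) ℂ := fun M =>
      !![(M 0 0 + conj (M 1 1)) / 2, (M 0 1 - conj (M 1 0)) / 2; -conj ((M 0 1 - conj (M 1 0)) / 2), conj ((M 0 0 + conj (M 1 1)) / 2)]
    Continuous fun x : Edge 3 L × Fin 2 × Fin 2 × Bool → ℝ => hsForm 2 (qP (rebuild x e)) (qP (rebuild x e)) := by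
  intro rebuild qP
  have hP : Continuous fun x : Edge 3 L × Fin 2 × Fin 2 × Bool → ℝ => qP (rebuild x e) := continuous_quatProj_rebuild e
  simp only [hsForm_apply]
  exact Complex.continuous_re.comp ((hP.matrix_mul hP.matrix_conjTranspose).matrix_trace)

/-- ★★ **`F̃ = χ·(F∘π)` is continuous** whenever `F` is: near a point where every `𝖯M_e` is nonzero `π` is continuous (normalised projection), and
near a point where some `𝖯M_e` vanishes the cut-off `χ` is identically `0`. [folklore] -/
theorem continuous_ext (F : GaugeConfig 3 L (Matrix.specialUnitaryGroup (Fin 2) ℂ) → ℝ) (hF : Continuous F) :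
    let rebuild : (Edge 3 L × Fin 2 × Fin 2 × Bool → ℝ) → Edge 3 L → Matrix (Fin 2) (Fin 2) ℂ :=
      fun x e => Matrix.of fun i j : Fin 2 => ((x (e, i, j, false) : ℝ) : ℂ) + ((x (e, i, j, true) : ℝ) : ℂ) * Complex.I
    let qP : Matrix (Fin 2) (Fin 2) ℂ → Matrix (Fin 2) (Fin 2) ℂ := fun M =>
      !![(M 0 0 + conj (M 1 1)) / 2, (M 0 1 - conj (M 1 0)) / 2; -conj ((M 0 1 - conj (M 1 0)) / 2), conj ((M 0 0 + conj (M 1 1)) / 2)]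
    let retr : (Edge 3 L × Fin 2 × Fin 2 × Bool → ℝ) → GaugeConfig 3 L (Matrix.specialUnitaryGroup (Fin 2) ℂ) := fun x e =>
      if h : hsForm 2 (qP (rebuild x e)) (qP (rebuild x e)) ≠ 0 then
        ⟨(Real.sqrt 2 / Real.sqrt (hsForm 2 (qP (rebuild x e)) (qP (rebuild x e)))) • qP (rebuild x e),
          normalize_quatProj_mem_specialUnitaryGroup_two (rebuild x e) h⟩
      else 1
    let cut : (Edge 3 L × Fin 2 × Fin 2 × Bool → ℝ) → ℝ := fun x =>
      ∏ e : Edge 3 L, Real.smoothTransition (8 * hsForm 2 (qP (rebuild x e)) (qP (rebuild x e)) - 1)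
    Continuous fun x => cut x * F (retr x) := by
  intro rebuild qP retr cut
  have hP : ∀ e, Continuous fun x : Edge 3 L × Fin 2 × Fin 2 × Bool → ℝ => qP (rebuild x e) := fun e => continuous_quatProj_rebuild e
  have hh : ∀ e, Continuous fun x : Edge 3 L × Fin 2 × Fin 2 × Bool → ℝ => hsForm 2 (qP (rebuild x e)) (qP (rebuild x e)) := fun e =>
    continuous_hsForm_quatProj_rebuild e
  have hcut : Continuous cut :=
    continuous_finsetProd _ fun e _ => Real.smoothTransition.continuous.comp (((hh e).const_mul 8).sub continuous_const)
  refine continuous_iff_continuousAt.2 fun x₀ => ?_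
  by_cases h0 : ∀ e, hsForm 2 (qP (rebuild x₀ e)) (qP (rebuild x₀ e)) ≠ 0
  · -- all projections nonzero: `π` is continuous at `x₀`
    have hretr : ContinuousAt retr x₀ := by
      refine continuousAt_pi.2 fun e => ?_
      rw [Topology.IsInducing.subtypeVal.continuousAt_iff]
      have hsq : Real.sqrt (hsForm 2 (qP (rebuild x₀ e)) (qP (rebuild x₀ e))) ≠ 0 :=
        Real.sqrt_ne_zero'.2 (lt_of_le_of_ne (hsForm_self_nonneg _) (Ne.symm (h0 e)))
      have hsm : ContinuousAt (fun y : Edge 3 L × Fin 2 × Fin 2 × Bool → ℝ =>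
          (Real.sqrt 2 / Real.sqrt (hsForm 2 (qP (rebuild y e)) (qP (rebuild y e)))) • qP (rebuild y e)) x₀ :=
        (continuousAt_const.div (hh e).continuousAt.sqrt hsq).smul (hP e).continuousAt
      refine hsm.congr_of_eventuallyEq ?_
      filter_upwards [(hh e).continuousAt.eventually_ne (h0 e)] with y hy
      change (((if h : hsForm 2 (qP (rebuild y e)) (qP (rebuild y e)) ≠ 0 then
          (⟨(Real.sqrt 2 / Real.sqrt (hsForm 2 (qP (rebuild y e)) (qP (rebuild y e)))) • qP (rebuild y e),
            normalize_quatProj_mem_specialUnitaryGroup_two (rebuild y e) h⟩ : Matrix.specialUnitaryGroup (Fin 2) ℂ)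
        else 1) : Matrix.specialUnitaryGroup (Fin 2) ℂ) : Matrix (Fin 2) (Fin 2) ℂ) = _
      rw [dif_pos hy]
    exact hcut.continuousAt.mul (hF.continuousAt.comp hretr)
  · -- some projection vanishes: the cut-off is `0` near `x₀`
    push Not at h0
    obtain ⟨e, he⟩ := h0
    have hlt : hsForm 2 (qP (rebuild x₀ e)) (qP (rebuild x₀ e)) < 1 / 8 := by rw [he]; norm_num
    have hev : ∀ᶠ y in 𝓝 x₀, cut y = 0 := by
      filter_upwards [((hh e).tendsto x₀).eventually_lt_const hlt] with y hy
      exact Finset.prod_eq_zero (Finset.mem_univ e) (Real.smoothTransition.zero_of_nonpos (by linarith))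
    refine (continuousAt_const (y := (0 : ℝ))).congr_of_eventuallyEq ?_
    filter_upwards [hev] with y hy
    rw [hy, zero_mul]

/-! ## §3. The modulus of `F̃` near the group -/

/-- ★★ **`|F̃(x) − F(Q)| ≤ L_F·12·√#E·r`** for `‖x − coords Q‖_∞ ≤ r ≤ 1/4` and `F` `L_F`-Lipschitz for `ρ_L`: the cut-off is `1`, each link of `π(x)` is
within chord `2√2·r/(1 − 2r) ≤ 4√2·r` of `Q_e` (radial distortion, G50), and `ρ_L ≤ (π/2)·√(Σ chord²)` (G41). [cite: ShenZhuZhu2022, §4.1] -/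
theorem ext_modulus (F : GaugeConfig 3 L (Matrix.specialUnitaryGroup (Fin 2) ℂ) → ℝ) {Lf : ℝ} (hLf : 0 ≤ Lf)
    (hlip : ∀ Q Q', |F Q' - F Q| ≤ Lf * Real.sqrt (torusRiemannDistSq (fundamentalLatticeRep 2) Q Q'))
    (Q : GaugeConfig 3 L (Matrix.specialUnitaryGroup (Fin 2) ℂ)) (x : Edge 3 L × Fin 2 × Fin 2 × Bool → ℝ) {r : ℝ} (hr : r ≤ 1 / 4) :
    let coords : GaugeConfig 3 L (Matrix.specialUnitaryGroup (Fin 2) ℂ) → (Edge 3 L × Fin 2 × Fin 2 × Bool → ℝ) :=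
      fun V q => (fun z : ℂ => if q.2.2.2 then z.im else z.re) ((fundamentalRep (Fin 2) (V q.1) : Matrix (Fin 2) (Fin 2) ℂ) q.2.1 q.2.2.1)
    let rebuild : (Edge 3 L × Fin 2 × Fin 2 × Bool → ℝ) → Edge 3 L → Matrix (Fin 2) (Fin 2) ℂ :=
      fun x e => Matrix.of fun i j : Fin 2 => ((x (e, i, j, false) : ℝ) : ℂ) + ((x (e, i, j, true) : ℝ) : ℂ) * Complex.I
    let qP : Matrix (Fin 2) (Fin 2) ℂ → Matrix (Fin 2) (Fin 2) ℂ := fun M =>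
      !![(M 0 0 + conj (M 1 1)) / 2, (M 0 1 - conj (M 1 0)) / 2; -conj ((M 0 1 - conj (M 1 0)) / 2), conj ((M 0 0 + conj (M 1 1)) / 2)]
    let retr : (Edge 3 L × Fin 2 × Fin 2 × Bool → ℝ) → GaugeConfig 3 L (Matrix.specialUnitaryGroup (Fin 2) ℂ) := fun x e =>
      if h : hsForm 2 (qP (rebuild x e)) (qP (rebuild x e)) ≠ 0 then
        ⟨(Real.sqrt 2 / Real.sqrt (hsForm 2 (qP (rebuild x e)) (qP (rebuild x e)))) • qP (rebuild x e),
          normalize_quatProj_mem_specialUnitaryGroup_two (rebuild x e) h⟩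
      else 1
    let cut : (Edge 3 L × Fin 2 × Fin 2 × Bool → ℝ) → ℝ := fun x =>
      ∏ e : Edge 3 L, Real.smoothTransition (8 * hsForm 2 (qP (rebuild x e)) (qP (rebuild x e)) - 1)
    ‖x - coords Q‖ ≤ r → |cut x * F (retr x) - F Q| ≤ Lf * (12 * Real.sqrt (Fintype.card (Edge 3 L)) * r) := by
  intro coords rebuild qP retr cut hx
  have hr0 : 0 ≤ r := le_trans (norm_nonneg _) hx
  have hx' : ‖x - coords Q‖ ≤ 1 / 4 := hx.trans hr
  have hcut : cut x = 1 := (retr_near Q x hx').2.1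
  have hval : ∀ e, ((retr x e : Matrix.specialUnitaryGroup (Fin 2) ℂ) : Matrix (Fin 2) (Fin 2) ℂ) =
      (Real.sqrt 2 / Real.sqrt (hsForm 2 (qP (rebuild x e)) (qP (rebuild x e)))) • qP (rebuild x e) := (retr_near Q x hx').2.2
  -- per-link chord bound `‖π(x)_e − Q_e‖² ≤ 32 r²`
  have hchord : ∀ e, hsForm 2 (((retr x e : Matrix.specialUnitaryGroup (Fin 2) ℂ) : Matrix (Fin 2) (Fin 2) ℂ) - (Q e : Matrix (Fin 2) (Fin 2) ℂ))
      (((retr x e : Matrix.specialUnitaryGroup (Fin 2) ℂ) : Matrix (Fin 2) (Fin 2) ℂ) - (Q e : Matrix (Fin 2) (Fin 2) ℂ)) ≤ 32 * r ^ 2 := by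
    intro e
    have hPe : qP (rebuild x e) = (Q e : Matrix (Fin 2) (Fin 2) ℂ) - qP (rebuild (coords Q - x) e) := (quatProj_rebuild_near Q x hx e).1
    have hT : hsForm 2 (qP (rebuild (coords Q - x) e)) (qP (rebuild (coords Q - x) e)) ≤ 8 * r ^ 2 := (quatProj_rebuild_near Q x hx e).2.1
    have hlow : Real.sqrt 2 * (1 - 2 * r) ≤ Real.sqrt (hsForm 2 (qP (rebuild x e)) (qP (rebuild x e))) := (quatProj_rebuild_near Q x hx e).2.2
    have h2 : (0 : ℝ) < Real.sqrt 2 := Real.sqrt_pos.2 (by norm_num)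
    have hm : 0 < Real.sqrt 2 * (1 - 2 * r) := mul_pos h2 (by linarith)
    have hQQ : hsForm 2 (Q e : Matrix (Fin 2) (Fin 2) ℂ) (Q e : Matrix (Fin 2) (Fin 2) ℂ) = 2 := hsForm_self_fundamentalRep (Q e)
    have hb : Real.sqrt 2 * (1 - 2 * r) ≤ Real.sqrt (hsForm 2 (Q e : Matrix (Fin 2) (Fin 2) ℂ) (Q e : Matrix (Fin 2) (Fin 2) ℂ)) := by
      rw [hQQ]; nlinarith
    have key := hsForm_radial_sub_radial_le (qP (rebuild x e)) (Q e : Matrix (Fin 2) (Fin 2) ℂ) hm h2.le hlow hb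
    rw [hQQ, div_self h2.ne', one_smul, ← hval e] at key
    have hdiff : qP (rebuild x e) - (Q e : Matrix (Fin 2) (Fin 2) ℂ) = -qP (rebuild (coords Q - x) e) := by rw [hPe]; abel
    rw [hdiff, LinearMap.BilinForm.neg_left, LinearMap.BilinForm.neg_right, neg_neg] at key
    have hratio : (Real.sqrt 2 / (Real.sqrt 2 * (1 - 2 * r))) ^ 2 ≤ 4 := by
      rw [div_mul_eq_div_div, div_self h2.ne', div_pow, one_pow, div_le_iff₀ (by nlinarith)]; nlinarith
    calc _ ≤ (Real.sqrt 2 / (Real.sqrt 2 * (1 - 2 * r))) ^ 2 * hsForm 2 (qP (rebuild (coords Q - x) e)) (qP (rebuild (coords Q - x) e)) := key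
      _ ≤ 4 * (8 * r ^ 2) := mul_le_mul hratio hT (hsForm_self_nonneg _) (by norm_num)
      _ = 32 * r ^ 2 := by ring
  -- hence `ρ_L(Q, π(x))² ≤ (π²/4)·#E·32r² ≤ (12·√#E·r)²`
  have hρ : torusRiemannDistSq (fundamentalLatticeRep 2) Q (retr x) ≤ (12 * Real.sqrt (Fintype.card (Edge 3 L)) * r) ^ 2 := by
    have hsum : ∑ e : Edge 3 L, hsForm 2 (((retr x e : Matrix.specialUnitaryGroup (Fin 2) ℂ) : Matrix (Fin 2) (Fin 2) ℂ) - (Q e : Matrix (Fin 2) (Fin 2) ℂ))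
        (((retr x e : Matrix.specialUnitaryGroup (Fin 2) ℂ) : Matrix (Fin 2) (Fin 2) ℂ) - (Q e : Matrix (Fin 2) (Fin 2) ℂ)) ≤
        Fintype.card (Edge 3 L) * (32 * r ^ 2) := by
      calc _ ≤ ∑ _e : Edge 3 L, 32 * r ^ 2 := Finset.sum_le_sum fun e _ => hchord e
        _ = Fintype.card (Edge 3 L) * (32 * r ^ 2) := by rw [Finset.sum_const, nsmul_eq_mul, Finset.card_univ]
    have hπ : Real.pi ^ 2 ≤ 16 := by nlinarith [Real.pi_le_four, Real.pi_pos]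
    have hcard : (0 : ℝ) ≤ Fintype.card (Edge 3 L) := Nat.cast_nonneg _
    calc torusRiemannDistSq (fundamentalLatticeRep 2) Q (retr x) ≤ Real.pi ^ 2 / 4 * (Fintype.card (Edge 3 L) * (32 * r ^ 2)) :=
          (torusRiemannDistSq_two_le Q (retr x)).trans (mul_le_mul_of_nonneg_left hsum (by positivity))
      _ ≤ 16 / 4 * (Fintype.card (Edge 3 L) * (32 * r ^ 2)) := by gcongr
      _ ≤ (12 * Real.sqrt (Fintype.card (Edge 3 L)) * r) ^ 2 := by
          rw [mul_pow, mul_pow, Real.sq_sqrt hcard]; nlinarith [sq_nonneg r]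
  have hρ' : Real.sqrt (torusRiemannDistSq (fundamentalLatticeRep 2) Q (retr x)) ≤ 12 * Real.sqrt (Fintype.card (Edge 3 L)) * r :=
    Real.sqrt_le_iff.2 ⟨by positivity, hρ⟩
  rw [hcut, one_mul]
  exact (hlip Q (retr x)).trans (mul_le_mul_of_nonneg_left hρ' hLf)

/-! ## §4. The local `ρ_L`-dilatation of the retraction under a common shift -/

/-- ★★ **Chord dilatation `≤ 1/(1 − 2r)` per link**: for `‖t‖_∞ ≤ r ≤ 1/4` and all `Q, Q'`, `e`:
`‖π(coords Q' − t)_e − π(coords Q − t)_e‖_F² ≤ (1/(1−2r))²·‖Q'_e − Q_e‖_F²` — both projections are `Q_e − 𝖯M_e(t)`, `Q'_e − 𝖯M_e(t)` with THE SAME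
perturbation, of norm `≥ √2(1 − 2r)`, and the radial projection onto the sphere of radius `√2` is `√2/m`-Lipschitz outside the ball of radius `m` (G50). [folklore] -/
theorem hsForm_retr_shift_sub_le (Q Q' : GaugeConfig 3 L (Matrix.specialUnitaryGroup (Fin 2) ℂ)) (t : Edge 3 L × Fin 2 × Fin 2 × Bool → ℝ) {r : ℝ}
    (hr : r ≤ 1 / 4) (e : Edge 3 L) :
    let coords : GaugeConfig 3 L (Matrix.specialUnitaryGroup (Fin 2) ℂ) → (Edge 3 L × Fin 2 × Fin 2 × Bool → ℝ) :=
      fun V q => (fun z : ℂ => if q.2.2.2 then z.im else z.re) ((fundamentalRep (Fin 2) (V q.1) : Matrix (Fin 2) (Fin 2) ℂ) q.2.1 q.2.2.1)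
    let rebuild : (Edge 3 L × Fin 2 × Fin 2 × Bool → ℝ) → Edge 3 L → Matrix (Fin 2) (Fin 2) ℂ :=
      fun x e => Matrix.of fun i j : Fin 2 => ((x (e, i, j, false) : ℝ) : ℂ) + ((x (e, i, j, true) : ℝ) : ℂ) * Complex.I
    let qP : Matrix (Fin 2) (Fin 2) ℂ → Matrix (Fin 2) (Fin 2) ℂ := fun M =>
      !![(M 0 0 + conj (M 1 1)) / 2, (M 0 1 - conj (M 1 0)) / 2; -conj ((M 0 1 - conj (M 1 0)) / 2), conj ((M 0 0 + conj (M 1 1)) / 2)]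
    let retr : (Edge 3 L × Fin 2 × Fin 2 × Bool → ℝ) → GaugeConfig 3 L (Matrix.specialUnitaryGroup (Fin 2) ℂ) := fun x e =>
      if h : hsForm 2 (qP (rebuild x e)) (qP (rebuild x e)) ≠ 0 then
        ⟨(Real.sqrt 2 / Real.sqrt (hsForm 2 (qP (rebuild x e)) (qP (rebuild x e)))) • qP (rebuild x e),
          normalize_quatProj_mem_specialUnitaryGroup_two (rebuild x e) h⟩
      else 1
    ‖t‖ ≤ r →
      hsForm 2 (((retr (coords Q' - t) e : Matrix.specialUnitaryGroup (Fin 2) ℂ) : Matrix (Fin 2) (Fin 2) ℂ) - ((retr (coords Q - t) e : Matrix.specialUnitaryGroup (Fin 2) ℂ) : Matrix (Fin 2) (Fin 2) ℂ))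
          (((retr (coords Q' - t) e : Matrix.specialUnitaryGroup (Fin 2) ℂ) : Matrix (Fin 2) (Fin 2) ℂ) - ((retr (coords Q - t) e : Matrix.specialUnitaryGroup (Fin 2) ℂ) : Matrix (Fin 2) (Fin 2) ℂ)) ≤
        (1 / (1 - 2 * r)) ^ 2 * hsForm 2 ((Q' e : Matrix (Fin 2) (Fin 2) ℂ) - (Q e : Matrix (Fin 2) (Fin 2) ℂ)) ((Q' e : Matrix (Fin 2) (Fin 2) ℂ) - (Q e : Matrix (Fin 2) (Fin 2) ℂ)) := by
  intro coords rebuild qP retr ht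
  have hr0 : 0 ≤ r := le_trans (norm_nonneg _) ht
  have hx : ‖coords Q - t - coords Q‖ ≤ r := by rw [sub_sub_cancel_left, norm_neg]; exact ht
  have hx' : ‖coords Q' - t - coords Q'‖ ≤ r := by rw [sub_sub_cancel_left, norm_neg]; exact ht
  -- the two projections and their common perturbation `T = 𝖯M_e(t)`
  have hP : qP (rebuild (coords Q - t) e) = (Q e : Matrix (Fin 2) (Fin 2) ℂ) - qP (rebuild (coords Q - (coords Q - t)) e) :=
    (quatProj_rebuild_near Q (coords Q - t) hx e).1
  have hP' : qP (rebuild (coords Q' - t) e) = (Q' e : Matrix (Fin 2) (Fin 2) ℂ) - qP (rebuild (coords Q' - (coords Q' - t)) e) :=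
    (quatProj_rebuild_near Q' (coords Q' - t) hx' e).1
  rw [sub_sub_cancel] at hP hP'
  have hlow : Real.sqrt 2 * (1 - 2 * r) ≤ Real.sqrt (hsForm 2 (qP (rebuild (coords Q - t) e)) (qP (rebuild (coords Q - t) e))) :=
    (quatProj_rebuild_near Q (coords Q - t) hx e).2.2
  have hlow' : Real.sqrt 2 * (1 - 2 * r) ≤ Real.sqrt (hsForm 2 (qP (rebuild (coords Q' - t) e)) (qP (rebuild (coords Q' - t) e))) :=
    (quatProj_rebuild_near Q' (coords Q' - t) hx' e).2.2
  have hval : ((retr (coords Q - t) e : Matrix.specialUnitaryGroup (Fin 2) ℂ) : Matrix (Fin 2) (Fin 2) ℂ) =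
      (Real.sqrt 2 / Real.sqrt (hsForm 2 (qP (rebuild (coords Q - t) e)) (qP (rebuild (coords Q - t) e)))) • qP (rebuild (coords Q - t) e) :=
    (retr_near Q (coords Q - t) (hx.trans hr)).2.2 e
  have hval' : ((retr (coords Q' - t) e : Matrix.specialUnitaryGroup (Fin 2) ℂ) : Matrix (Fin 2) (Fin 2) ℂ) =
      (Real.sqrt 2 / Real.sqrt (hsForm 2 (qP (rebuild (coords Q' - t) e)) (qP (rebuild (coords Q' - t) e)))) • qP (rebuild (coords Q' - t) e) :=
    (retr_near Q' (coords Q' - t) (hx'.trans hr)).2.2 e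
  have h2 : (0 : ℝ) < Real.sqrt 2 := Real.sqrt_pos.2 (by norm_num)
  have hm : 0 < Real.sqrt 2 * (1 - 2 * r) := mul_pos h2 (by linarith)
  have key := hsForm_radial_sub_radial_le (qP (rebuild (coords Q' - t) e)) (qP (rebuild (coords Q - t) e)) hm h2.le hlow' hlow
  rw [← hval, ← hval'] at key
  have hdiff : qP (rebuild (coords Q' - t) e) - qP (rebuild (coords Q - t) e) = (Q' e : Matrix (Fin 2) (Fin 2) ℂ) - (Q e : Matrix (Fin 2) (Fin 2) ℂ) := by
    rw [hP, hP']; abel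
  rw [hdiff] at key
  have hratio : (Real.sqrt 2 / (Real.sqrt 2 * (1 - 2 * r))) ^ 2 = (1 / (1 - 2 * r)) ^ 2 := by
    rw [div_mul_eq_div_div, div_self h2.ne']
  rw [hratio] at key
  exact key

/-- ★★★ **Local `ρ_L`-dilatation of the retraction under a common shift**: for `‖t‖_∞ ≤ r ≤ 1/4`, `u < 1` and `Q, Q'` with
`(1/(1−2r))²·ρ_L(Q,Q')² ≤ 8u`:  `ρ_L(π(coords Q − t), π(coords Q' − t))² ≤ ((1/(1−2r))²/(1 − u))·ρ_L(Q,Q')²` — per link, chord before `≤` arc (G41),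
chord after `≤ (1/(1−2r))·`chord before, and arc after `≤ chord/√(1 − chord²/8) ≤ chord/√(1 − u)` (G50). [cite: GallotHulinLafontaine2004, 2.91] -/
theorem torusRiemannDistSq_retr_shift_le (Q Q' : GaugeConfig 3 L (Matrix.specialUnitaryGroup (Fin 2) ℂ)) (t : Edge 3 L × Fin 2 × Fin 2 × Bool → ℝ)
    {r u : ℝ} (hr : r ≤ 1 / 4) (hu : u < 1) :
    let coords : GaugeConfig 3 L (Matrix.specialUnitaryGroup (Fin 2) ℂ) → (Edge 3 L × Fin 2 × Fin 2 × Bool → ℝ) :=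
      fun V q => (fun z : ℂ => if q.2.2.2 then z.im else z.re) ((fundamentalRep (Fin 2) (V q.1) : Matrix (Fin 2) (Fin 2) ℂ) q.2.1 q.2.2.1)
    let rebuild : (Edge 3 L × Fin 2 × Fin 2 × Bool → ℝ) → Edge 3 L → Matrix (Fin 2) (Fin 2) ℂ :=
      fun x e => Matrix.of fun i j : Fin 2 => ((x (e, i, j, false) : ℝ) : ℂ) + ((x (e, i, j, true) : ℝ) : ℂ) * Complex.I
    let qP : Matrix (Fin 2) (Fin 2) ℂ → Matrix (Fin 2) (Fin 2) ℂ := fun M =>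
      !![(M 0 0 + conj (M 1 1)) / 2, (M 0 1 - conj (M 1 0)) / 2; -conj ((M 0 1 - conj (M 1 0)) / 2), conj ((M 0 0 + conj (M 1 1)) / 2)]
    let retr : (Edge 3 L × Fin 2 × Fin 2 × Bool → ℝ) → GaugeConfig 3 L (Matrix.specialUnitaryGroup (Fin 2) ℂ) := fun x e =>
      if h : hsForm 2 (qP (rebuild x e)) (qP (rebuild x e)) ≠ 0 then
        ⟨(Real.sqrt 2 / Real.sqrt (hsForm 2 (qP (rebuild x e)) (qP (rebuild x e)))) • qP (rebuild x e),
          normalize_quatProj_mem_specialUnitaryGroup_two (rebuild x e) h⟩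
      else 1
    ‖t‖ ≤ r → (1 / (1 - 2 * r)) ^ 2 * torusRiemannDistSq (fundamentalLatticeRep 2) Q Q' ≤ 8 * u →
      torusRiemannDistSq (fundamentalLatticeRep 2) (retr (coords Q - t)) (retr (coords Q' - t)) ≤
        (1 / (1 - 2 * r)) ^ 2 / (1 - u) * torusRiemannDistSq (fundamentalLatticeRep 2) Q Q' := by
  intro coords rebuild qP retr ht hsmall
  set lam2 : ℝ := (1 / (1 - 2 * r)) ^ 2 with hlam2
  have hlam0 : 0 ≤ lam2 := sq_nonneg _
  have hD0 : 0 ≤ torusRiemannDistSq (fundamentalLatticeRep 2) Q Q' := by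
    unfold torusRiemannDistSq; exact Finset.sum_nonneg fun _ _ => sq_nonneg _
  have h1u : 0 < 1 - u := by linarith
  -- per-link squared chords before the retraction are bounded by `ρ_L(Q,Q')²`
  have hce : ∀ e, hsForm 2 ((Q' e : Matrix (Fin 2) (Fin 2) ℂ) - (Q e : Matrix (Fin 2) (Fin 2) ℂ)) ((Q' e : Matrix (Fin 2) (Fin 2) ℂ) - (Q e : Matrix (Fin 2) (Fin 2) ℂ)) ≤
      torusRiemannDistSq (fundamentalLatticeRep 2) Q Q' := fun e =>
    (Finset.single_le_sum (f := fun e' : Edge 3 L => hsForm 2 ((Q' e' : Matrix (Fin 2) (Fin 2) ℂ) - (Q e' : Matrix (Fin 2) (Fin 2) ℂ))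
      ((Q' e' : Matrix (Fin 2) (Fin 2) ℂ) - (Q e' : Matrix (Fin 2) (Fin 2) ℂ))) (fun _ _ => hsForm_self_nonneg _) (Finset.mem_univ e)).trans
      (sum_hsForm_sub_le_torusRiemannDistSq_two Q Q')
  -- per-link bound after the retraction
  have hedge : ∀ e, (fundamentalLatticeRep 2).riemannDist (retr (coords Q - t) e) (retr (coords Q' - t) e) ^ 2 ≤
      lam2 / (1 - u) * hsForm 2 ((Q' e : Matrix (Fin 2) (Fin 2) ℂ) - (Q e : Matrix (Fin 2) (Fin 2) ℂ)) ((Q' e : Matrix (Fin 2) (Fin 2) ℂ) - (Q e : Matrix (Fin 2) (Fin 2) ℂ)) := by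
    intro e
    set c2 : ℝ := hsForm 2 ((Q' e : Matrix (Fin 2) (Fin 2) ℂ) - (Q e : Matrix (Fin 2) (Fin 2) ℂ)) ((Q' e : Matrix (Fin 2) (Fin 2) ℂ) - (Q e : Matrix (Fin 2) (Fin 2) ℂ)) with hc2
    set d2 : ℝ := hsForm 2 (((retr (coords Q' - t) e : Matrix.specialUnitaryGroup (Fin 2) ℂ) : Matrix (Fin 2) (Fin 2) ℂ) - ((retr (coords Q - t) e : Matrix.specialUnitaryGroup (Fin 2) ℂ) : Matrix (Fin 2) (Fin 2) ℂ))
      (((retr (coords Q' - t) e : Matrix.specialUnitaryGroup (Fin 2) ℂ) : Matrix (Fin 2) (Fin 2) ℂ) - ((retr (coords Q - t) e : Matrix.specialUnitaryGroup (Fin 2) ℂ) : Matrix (Fin 2) (Fin 2) ℂ)) with hd2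
    have hc0 : 0 ≤ c2 := hsForm_self_nonneg _
    have hd0 : 0 ≤ d2 := hsForm_self_nonneg _
    have hdc : d2 ≤ lam2 * c2 := hsForm_retr_shift_sub_le Q Q' t hr e ht
    have hd8 : d2 ≤ 8 * u := hdc.trans ((mul_le_mul_of_nonneg_left (hce e) hlam0).trans hsmall)
    have hd8' : d2 < 8 := by linarith
    have hρ := riemannDist_two_le_chord_div_sqrt (retr (coords Q - t) e) (retr (coords Q' - t) e) hd8'
    have hρ0 : 0 ≤ (fundamentalLatticeRep 2).riemannDist (retr (coords Q - t) e) (retr (coords Q' - t) e) := (fundamentalLatticeRep 2).riemannDist_nonneg _ _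
    have hden : 0 < 1 - d2 / 8 := by linarith
    calc (fundamentalLatticeRep 2).riemannDist (retr (coords Q - t) e) (retr (coords Q' - t) e) ^ 2 ≤ (Real.sqrt d2 / Real.sqrt (1 - d2 / 8)) ^ 2 :=
          pow_le_pow_left₀ hρ0 hρ 2
      _ = d2 / (1 - d2 / 8) := by rw [div_pow, Real.sq_sqrt hd0, Real.sq_sqrt hden.le]
      _ ≤ d2 / (1 - u) := div_le_div_of_nonneg_left hd0 h1u (by linarith)
      _ ≤ lam2 * c2 / (1 - u) := div_le_div_of_nonneg_right hdc h1u.le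
      _ = lam2 / (1 - u) * c2 := by ring
  calc torusRiemannDistSq (fundamentalLatticeRep 2) (retr (coords Q - t)) (retr (coords Q' - t))
        = ∑ e, (fundamentalLatticeRep 2).riemannDist (retr (coords Q - t) e) (retr (coords Q' - t) e) ^ 2 := rfl
    _ ≤ ∑ e, lam2 / (1 - u) * hsForm 2 ((Q' e : Matrix (Fin 2) (Fin 2) ℂ) - (Q e : Matrix (Fin 2) (Fin 2) ℂ)) ((Q' e : Matrix (Fin 2) (Fin 2) ℂ) - (Q e : Matrix (Fin 2) (Fin 2) ℂ)) :=
        Finset.sum_le_sum fun e _ => hedge e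
    _ = lam2 / (1 - u) * ∑ e, hsForm 2 ((Q' e : Matrix (Fin 2) (Fin 2) ℂ) - (Q e : Matrix (Fin 2) (Fin 2) ℂ)) ((Q' e : Matrix (Fin 2) (Fin 2) ℂ) - (Q e : Matrix (Fin 2) (Fin 2) ℂ)) := by
        rw [Finset.mul_sum]
    _ ≤ lam2 / (1 - u) * torusRiemannDistSq (fundamentalLatticeRep 2) Q Q' :=
        mul_le_mul_of_nonneg_left (sum_hsForm_sub_le_torusRiemannDistSq_two Q Q') (div_nonneg hlam0 h1u.le)

end Summit.QuantumFields.YangMills.Theorems.ColdStartUniversality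

end
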